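import Summits.ValiantsHypothesis.ValiantsHypothesis.Theorems.GrenetZeonDualUnipotentThreeHalvesLongMassIrreducibilityFree

/-!
# `GrenetZeon.DualUnipotentThreeHalves` (stmt-ValiantsHypothesis-24318), line `slow_core`, stub (c) `SlowCore.LongMassSlowLawInv`:
# the stub follows from an `n`-FREE COARSENING LAW ("Gerstenhaber at every window order")

(c) ⟺ `LongMassSlowLawAll` (✓ `…LongMassIrreducibilityFree.inv_iff_all`): every nilpotent affine `b × b` pencil `N` over the `n²`
coordinates has a whole-pencil certificate of PRICE `n·k + codim K ≤ c·√n·b`.  The price mixes the window parameter `n` with the pencil;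
this file separates them.  Say `N` obeys the **coarsening law with constant `C` at order `k`** if it has a direction space `K` with
`SlowCore.Ledger n b N ⊤ K k` (window order `k`) and `codim K · (k + 1) ≤ C · b²`.  For triangularisable pencils this is the BLOCK
COARSENING of the flag into `k + 1` runs (codim `≤ Σ_i C(b_i, 2) ≤ b²/(2(k+1))`, ✓ `…LongMassTriangular` / `Negative/FlagCheapOfTriangularisable`
in flag currency); at `k = 0` with `C = 1/2` it is exactly GERSTENHABER's theorem (`dim ≤ b(b−1)/2`: order-`0` ledgers are freezes,
✓ `LedgerIndex.ledger_zero_iff_forall_linMat_eq_zero`).  The repeated-block pencils `S_ℓ ⊗ X` of ✓ `…MonomialWalkHelix` obey it with room to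
spare (`codim · (k+1) ≤ b²/ℓ` in the flat range).  The SHARP constant `C = 1/2` fails already for the `3 × 3` gadget
`[[0,x,0],[y,0,x],[0,−y,0]]` at `k = 1` (no window-1 direction, `codim = 2 > 1`), so only a constant-`C` law can hold in general (memo
`FIFTEENTH-HAND.md` §4, evidence on 24318/8062).

* ★ `relCert_of_coarsening` — ONE ORDER SUFFICES: if `N` obeys the law with constant `C` at the order `k = b / (√n + 1)`, then
  `RelCert n b N ((2C + 2)·(√n·b))` (`n ≥ 1`).  Arithmetic: `n·k ≤ (√n+1)²·k ≤ (√n+1)·b ≤ 2√n·b` and `codim ≤ C·b²/(k+1) ≤ C·b·(√n+1) ≤ 2C·√n·b`.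
* ★ `relCert_of_coarsening_all` — the law at every order gives the same.
* ★ `longMassSlowLawAll_of_coarseningLaw`, `longMassSlowLawInv_of_coarseningLaw` — BY NAME: a uniform coarsening law (one `C` for all
  nilpotent affine pencils, all `n ≥ 1`, at the single order `b / (√n + 1)`) implies (c) with `c = 2C + 2`, `n₀ = 1`.

REV 2: the converse bookkeeping `coarsening_of_relCert`, `coarseningShadow_of_longMassSlowLawInv` — a certificate of price `c√n·b` IS the law at
its own order `k ≤ c·b/√n` (constant `≈ c² + c`); so (c) is bracketed between the law at order `b/(√n+1)` and at some order `≤ c·b/√n`.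

So the research content of (c) is LOCATED in an `n`-free extremal statement about nilpotent matrix spaces: «is `𝔫_b` (block coarsening) the most
expensive nilpotent space at every window order, up to a constant?»  Violator shape (same as the memo's for (c)): a pencil with NO window-`k`
direction space of codimension `≤ C b²/(k+1)` at `k ≈ b/√n` — "massive and window-flat".
HONEST FRAMING.  A REDUCTION / support lemma (`--supports stmt-ValiantsHypothesis-24318`); the coarsening law is NOT proved here and NOT claimed;
(c) `LongMassSlowLawInv` (RESEARCH — OPEN), S3, 24318, 8062 and `VP ≠ VNP` are NOT proved.  Def-free (the law is an inline hypothesis), no sorry.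
-/

set_option linter.dupNamespace false
set_option autoImplicit false

noncomputable section

namespace Summit.ValiantsHypothesis.ValiantsHypothesis.Theorems.GrenetZeon.CoarseningLaw

open Summit.ValiantsHypothesis.ValiantsHypothesis.Cruxes.TwoDimCoefficients.DimTwoCases (AffMat IsAffine)
open Summit.ValiantsHypothesis.ValiantsHypothesis.Theorems.GrenetZeon.SlowCore (Ledger RelCert LongMassSlowLawInv)
open Summit.ValiantsHypothesis.ValiantsHypothesis.Theorems.GrenetZeon.LongMassIrreducibilityFree (LongMassSlowLawAll inv_of_all)

variable {n m : ℕ}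

/-- Arithmetic of the window term: `n · (b / (√n + 1)) ≤ 2 · √n · b` (`n ≥ 1`). [folklore] -/
theorem window_term_le (hn : 1 ≤ n) (b : ℕ) : n * (b / (Nat.sqrt n + 1)) ≤ 2 * (Nat.sqrt n * b) := by
  set s := Nat.sqrt n with hs
  have hlt : n < (s + 1) * (s + 1) := Nat.lt_succ_sqrt n
  have hspos : 1 ≤ s := by
    rw [hs]; exact Nat.succ_le_of_lt (Nat.sqrt_pos.mpr (by omega))
  have hdiv : (s + 1) * (b / (s + 1)) ≤ b := Nat.mul_div_le b (s + 1)
  calc n * (b / (s + 1)) ≤ (s + 1) * (s + 1) * (b / (s + 1)) := Nat.mul_le_mul_right _ hlt.le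
    _ = (s + 1) * ((s + 1) * (b / (s + 1))) := by ring
    _ ≤ (s + 1) * b := Nat.mul_le_mul_left _ hdiv
    _ ≤ (s + s) * b := Nat.mul_le_mul_right _ (by omega)
    _ = 2 * (s * b) := by ring

/-- Arithmetic of the codimension term: `D · (k + 1) ≤ C · b²` with `k = b / (√n + 1)` gives `D ≤ 2·C·√n·b` (`n ≥ 1`). [folklore] -/
theorem codim_term_le (hn : 1 ≤ n) (b C D : ℕ) (hD : D * (b / (Nat.sqrt n + 1) + 1) ≤ C * (b * b)) :
    D ≤ 2 * C * (Nat.sqrt n * b) := by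
  set s := Nat.sqrt n with hs
  have hspos : 1 ≤ s := by
    rw [hs]; exact Nat.succ_le_of_lt (Nat.sqrt_pos.mpr (by omega))
  set k := b / (s + 1) with hk
  -- `b < (k + 1) · (s + 1)`
  have hb : b < (k + 1) * (s + 1) := by
    have := Nat.lt_div_mul_add (a := b) (b := s + 1) (Nat.succ_pos s)
    rw [← hk] at this
    nlinarith [this]
  rcases Nat.eq_zero_or_pos b with hb0 | hbpos
  · subst hb0
    have : D * (0 / (s + 1) + 1) ≤ 0 := by simpa using hD
    have hD0 : D = 0 := by simpa using this
    simp [hD0]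
  · -- `D (k+1) ≤ C b² < C b (k+1)(s+1)` would give `D ≤ C b (s+1)`; do it with `Nat` care.
    have h1 : D * (k + 1) ≤ C * b * b := by simpa [mul_assoc] using hD
    have h2 : D * (k + 1) * b ≤ C * b * ((k + 1) * (s + 1)) * b := by
      have := Nat.mul_le_mul_right b h1
      calc D * (k + 1) * b ≤ C * b * b * b := this
        _ ≤ C * b * ((k + 1) * (s + 1)) * b := by
            apply Nat.mul_le_mul_right
            apply Nat.mul_le_mul_left
            exact hb.le
    -- cancel `(k + 1) · b > 0`
    have h3 : D ≤ C * b * (s + 1) := by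
      have hpos : 0 < (k + 1) * b := Nat.mul_pos (Nat.succ_pos k) hbpos
      have : D * ((k + 1) * b) ≤ C * b * (s + 1) * ((k + 1) * b) := by
        calc D * ((k + 1) * b) = D * (k + 1) * b := by ring
          _ ≤ C * b * ((k + 1) * (s + 1)) * b := h2
          _ = C * b * (s + 1) * ((k + 1) * b) := by ring
      exact Nat.le_of_mul_le_mul_right this hpos
    calc D ≤ C * b * (s + 1) := h3
      _ ≤ C * b * (s + s) := Nat.mul_le_mul_left _ (by omega)
      _ = 2 * C * (s * b) := by ring

/-- ★ **ONE ORDER OF THE COARSENING LAW PAYS FOR (c).**  If the affine pencil `N` has a window-`k` direction space `K`, `k = b / (√n + 1)`, with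
`codim K · (k + 1) ≤ C · b²`, then `N` has a whole-pencil certificate of price `≤ (2C + 2)·√n·b`. -/
theorem relCert_of_coarsening (hn : 1 ≤ n) (N : AffMat n m) (C : ℕ) (K : Submodule ℂ (Fin n × Fin n → ℂ))
    (hK : Ledger n m N (fun _ => True) K (m / (Nat.sqrt n + 1)))
    (hcodim : (n * n - Module.finrank ℂ K) * (m / (Nat.sqrt n + 1) + 1) ≤ C * (m * m)) :
    RelCert n m N ((2 * C + 2) * (Nat.sqrt n * m)) := by
  refine ⟨K, m / (Nat.sqrt n + 1), hK, ?_⟩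
  have h1 := window_term_le hn m
  have h2 := codim_term_le hn m C (n * n - Module.finrank ℂ K) hcodim
  calc n * (m / (Nat.sqrt n + 1)) + (n * n - Module.finrank ℂ K)
      ≤ 2 * (Nat.sqrt n * m) + 2 * C * (Nat.sqrt n * m) := Nat.add_le_add h1 h2
    _ = (2 * C + 2) * (Nat.sqrt n * m) := by ring

/-- ★ The coarsening law AT EVERY ORDER (the natural `n`-free form: for every `k` a window-`k` direction space of codimension `≤ C·b²/(k+1)`)
gives a certificate of price `≤ (2C + 2)·√n·b` for every `n ≥ 1`. -/
theorem relCert_of_coarsening_all (hn : 1 ≤ n) (N : AffMat n m) (C : ℕ)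
    (h : ∀ k : ℕ, ∃ K : Submodule ℂ (Fin n × Fin n → ℂ), Ledger n m N (fun _ => True) K k ∧
      (n * n - Module.finrank ℂ K) * (k + 1) ≤ C * (m * m)) :
    RelCert n m N ((2 * C + 2) * (Nat.sqrt n * m)) := by
  obtain ⟨K, hK, hcodim⟩ := h (m / (Nat.sqrt n + 1))
  exact relCert_of_coarsening hn N C K hK hcodim

/-- ★ **BY NAME: a UNIFORM COARSENING LAW implies (c) for all pencils** (`LongMassSlowLawAll`, `c = 2C + 2`, `n₀ = 1`).  The law (inline hypothesis,
NOT proved, NOT claimed): one constant `C` such that every nilpotent affine `b × b` pencil over the `n²` coordinates (`n ≥ 1`) has, at the order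
`k = b / (√n + 1)`, a window-`k` direction space of codimension `· (k+1) ≤ C · b²`. -/
theorem longMassSlowLawAll_of_coarseningLaw
    (hlaw : ∃ C : ℕ, ∀ n : ℕ, 1 ≤ n → ∀ (b : ℕ) (B : AffMat n b), IsAffine B → B ^ b = 0 →
      ∃ K : Submodule ℂ (Fin n × Fin n → ℂ), Ledger n b B (fun _ => True) K (b / (Nat.sqrt n + 1)) ∧
        (n * n - Module.finrank ℂ K) * (b / (Nat.sqrt n + 1) + 1) ≤ C * (b * b)) :
    LongMassSlowLawAll := by
  obtain ⟨C, h⟩ := hlaw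
  refine ⟨2 * C + 2, 1, fun n hn b B hB hnil => ?_⟩
  obtain ⟨K, hK, hcodim⟩ := h n hn b B hB hnil
  exact relCert_of_coarsening hn B C K hK hcodim

/-- ★ **BY NAME: a uniform coarsening law implies the registered stub (c) `LongMassSlowLawInv`** (through ✓ `inv_of_all`). -/
theorem longMassSlowLawInv_of_coarseningLaw
    (hlaw : ∃ C : ℕ, ∀ n : ℕ, 1 ≤ n → ∀ (b : ℕ) (B : AffMat n b), IsAffine B → B ^ b = 0 →
      ∃ K : Submodule ℂ (Fin n × Fin n → ℂ), Ledger n b B (fun _ => True) K (b / (Nat.sqrt n + 1)) ∧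
        (n * n - Module.finrank ℂ K) * (b / (Nat.sqrt n + 1) + 1) ≤ C * (b * b)) :
    LongMassSlowLawInv :=
  inv_of_all (longMassSlowLawAll_of_coarseningLaw hlaw)

/-- The `n`-free form at every order implies the single-order form used above (bookkeeping). -/
theorem coarseningLaw_single_of_all
    (hlaw : ∃ C : ℕ, ∀ n : ℕ, 1 ≤ n → ∀ (b : ℕ) (B : AffMat n b), IsAffine B → B ^ b = 0 → ∀ k : ℕ,
      ∃ K : Submodule ℂ (Fin n × Fin n → ℂ), Ledger n b B (fun _ => True) K k ∧
        (n * n - Module.finrank ℂ K) * (k + 1) ≤ C * (b * b)) :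
    ∃ C : ℕ, ∀ n : ℕ, 1 ≤ n → ∀ (b : ℕ) (B : AffMat n b), IsAffine B → B ^ b = 0 →
      ∃ K : Submodule ℂ (Fin n × Fin n → ℂ), Ledger n b B (fun _ => True) K (b / (Nat.sqrt n + 1)) ∧
        (n * n - Module.finrank ℂ K) * (b / (Nat.sqrt n + 1) + 1) ≤ C * (b * b) := by
  obtain ⟨C, h⟩ := hlaw
  exact ⟨C, fun n hn b B hB hnil => h n hn b B hB hnil _⟩

/-- ★ (c) from the `n`-free coarsening law at every order. -/
theorem longMassSlowLawInv_of_coarseningLaw_all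
    (hlaw : ∃ C : ℕ, ∀ n : ℕ, 1 ≤ n → ∀ (b : ℕ) (B : AffMat n b), IsAffine B → B ^ b = 0 → ∀ k : ℕ,
      ∃ K : Submodule ℂ (Fin n × Fin n → ℂ), Ledger n b B (fun _ => True) K k ∧
        (n * n - Module.finrank ℂ K) * (k + 1) ≤ C * (b * b)) :
    LongMassSlowLawInv :=
  longMassSlowLawInv_of_coarseningLaw (coarseningLaw_single_of_all hlaw)

/-! ## (rev 2) The converse bookkeeping: a certificate IS one order of the coarsening law -/

/-- **A certificate of price `P` is the coarsening law at its own order**: `RelCert n b N P` gives a window-`k` direction space with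
`n·k ≤ P` and `codim ≤ P`, hence `codim · (k + 1) ≤ P · (k + 1)` and `n · (codim · (k+1)) ≤ P · (P + n)`.  With `P = c·√n·b` this is the law with
constant `≈ c² + c` at the order `k ≤ c·b/√n` (and, by monotonicity of ledgers in `k`, ✓ `SlowCore.ledger_mono`, at every larger order). -/
theorem coarsening_of_relCert (N : AffMat n m) {P : ℕ} (h : RelCert n m N P) :
    ∃ (K : Submodule ℂ (Fin n × Fin n → ℂ)) (k : ℕ), Ledger n m N (fun _ => True) K k ∧ n * k ≤ P ∧
      (n * n - Module.finrank ℂ K) ≤ P ∧ n * ((n * n - Module.finrank ℂ K) * (k + 1)) ≤ P * (P + n) := by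
  obtain ⟨K, k, hK, hprice⟩ := h
  have hk : n * k ≤ P := le_trans (Nat.le_add_right _ _) hprice
  have hc : n * n - Module.finrank ℂ K ≤ P := le_trans (Nat.le_add_left _ _) hprice
  refine ⟨K, k, hK, hk, hc, ?_⟩
  calc n * ((n * n - Module.finrank ℂ K) * (k + 1)) = (n * n - Module.finrank ℂ K) * (n * k + n) := by ring
    _ ≤ P * (P + n) := Nat.mul_le_mul hc (Nat.add_le_add_right hk n)

/-- Ledgers found at one order serve every larger order (window-`k` ⟹ window-`k'` for `k ≤ k'`). -/
theorem coarsening_mono (N : AffMat n m) {K : Submodule ℂ (Fin n × Fin n → ℂ)} {k k' : ℕ} (hk : k ≤ k')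
    (hK : Ledger n m N (fun _ => True) K k) : Ledger n m N (fun _ => True) K k' :=
  SlowCore.ledger_mono hK (fun _ h => h) le_rfl hk

/-- ★ **BY NAME: (c) ⟹ the coarsening law at the certificate's order, uniformly** — every `IrreducibleInv` nilpotent affine pencil (`n ≥ n₀`)
has a window-`k` direction space with `n·k ≤ c√n·b` and `codim ≤ c√n·b` (so `n·codim·(k+1) ≤ c√n b·(c√n b + n)`).  Together with
✓ `longMassSlowLawInv_of_coarseningLaw` this brackets the stub between the coarsening law at the order `b/(√n+1)` (sufficient) and at some order
`≤ c·b/√n` (necessary): (c) IS a coarsening law, up to the constant in the order. -/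
theorem coarseningShadow_of_longMassSlowLawInv (h : LongMassSlowLawInv) :
    ∃ c n₀ : ℕ, ∀ n ≥ n₀, ∀ b : ℕ, ∀ B : AffMat n b, IsAffine B → B ^ b = 0 → SlowCore.IrreducibleInv B →
      ∃ (K : Submodule ℂ (Fin n × Fin n → ℂ)) (k : ℕ), Ledger n b B (fun _ => True) K k ∧ n * k ≤ c * (Nat.sqrt n * b) ∧
        (n * n - Module.finrank ℂ K) ≤ c * (Nat.sqrt n * b) ∧
        n * ((n * n - Module.finrank ℂ K) * (k + 1)) ≤ c * (Nat.sqrt n * b) * (c * (Nat.sqrt n * b) + n) := by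
  obtain ⟨c, n₀, h⟩ := h
  exact ⟨c, n₀, fun n hn b B hB hnil hirr => coarsening_of_relCert B (h n hn b B hB hnil hirr)⟩

end Summit.ValiantsHypothesis.ValiantsHypothesis.Theorems.GrenetZeon.CoarseningLaw

end
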